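import Summits.CriticalPhenomena.Ising3DConformalLimit.Theses.PlanarCornerRotations
import HarnessLib

/-!
# Crux `PlanarCornerRotations.CornerTransfer` (stmt-CriticalPhenomena-4631) — birth skeleton, line `birth`

Registered by `planner-skel-stmt-CriticalPhenomena-4631-0` (skeleton-register one-shot, BC3; 2026-08-17) for route
`route-CriticalPhenomena-PlanarCornerRotations` (sub-problem `Ising3DConformalLimit`; re-audit bin REPAIRABLE:
the crux had no registered skeleton).  Line card: `Lines/birth.md`.

## The crux (verbatim shape of the route decl)

`CornerTransfer` = (P) `PlanarMassiveIsotropy` (every normalised, non-degenerate pointwise scaling limit of the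
full-plane square-lattice spin correlators at `β = β_c(2) − mδ`, `m > 0`, is `O(2)`-invariant) `→` for every
`(ρ, Δ, S)` with (H1) `ρ > 0` on `(0,1]`, (H2) `HasPointwiseScalingLimit (criticalCorr 3) ρ S`, (H3) `S = 0` off
`NonCoincident`, (H4) `IsNondegenerateTwoPoint S`, (H5) `IsTranslationInvariant S`, (H6) `IsScaleCovariant Δ S`:
`S n (R x₁, …, R xₙ) = S n x` for every linear isometry `R` of `ℝ³` with `R e₃ = e₃` (all of `Stab(e₃) ≅ O(2)_z`).

## The line `birth`: cut at the ORDER of the correlation functions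

* `stub_twoPointIsotropy` (order 2).  For every `(ρ, Δ, S)` with (H1), (H2), (H4), (H5), (H6) the two-point kernel
  is isotropic off the origin: `S 2 ![0, R x] = S 2 ![0, x]` for all linear isometries `R` and all `x ≠ 0`.
  This is VERBATIM the signature of item stmt-CriticalPhenomena-1984 (`HyperoctahedralRP.TwoPointLimitIsotropic`),
  closed/proved 2026-08-16 by `Summit.CriticalPhenomena.Ising3DConformalLimit.HyperoctahedralRPTwoPoint.twoPointLimitIsotropic_proof`
  (`Theorems/HyperoctahedralRPTwoPointLimitIsotropicHolds.lean`: nine-mirror reflection positivity of the `ℤ³` plus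
  state passed to the limit kernel, `twoPointKernelOfLimit_proof`, + nine-mirror RP rigidity of homogeneous kernels,
  `Cruxes.HRP2Rigidity.XRayMellin.HRP2Rigidity_of`).
* `stub_nPointUpgradeFromTwoPoint` (orders `≥ 3`).  (H1)–(H6) + two-point kernel isotropy off `0` ⇒
  `IsRotationInvariant S` (all orders, all of `O(3)`).  VERBATIM the signature of item stmt-CriticalPhenomena-8367
  (`GaussianScaleMixture.RotationUpgradeFromTwoPoint`), closed/proved 2026-08-16 by
  `Summit.CriticalPhenomena.Ising3DConformalLimit.Cruxes.RotationUpgradeFromTwoPoint.NullLaplacianEdgeGaussianity.RotationUpgradeFromTwoPoint_of`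
  (`Theorems/GaussianScaleMixtureRotationUpgradeFromTwoPoint.lean`: Wick / Aizenman–Newman dichotomy on the Gaussian
  locus; OS null vector + Bôcher–Liouville at `Δ = 1/2`; unit sigma bound + quarter-turn Liouville inside the window).
* `CornerTransfer_of (h₁ : Statement.stub_twoPointIsotropy) (h₂ : Statement.stub_nPointUpgradeFromTwoPoint) :
  CornerTransfer` — the composition, kernel-checked and sorry-free: given (P) (unused) and `(ρ, Δ, S)` with
  (H1)–(H6), `h₁` gives two-point isotropy, `h₂` upgrades it to `IsRotationInvariant S`, which is specialised to the
  isometries fixing `e₃`.  (`Statement.stub_x := type_of% stub_x` names each stub's statement, so the hypotheses of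
  the composition are the declared stubs BY NAME, as the layer-invariant audit requires.)

Hardest stub: `stub_nPointUpgradeFromTwoPoint` (the `n ≥ 3` content; XL as mathematics).  As work remaining IN THIS
TREE both stubs are citations (one `exact` each, importing the two Theorems modules named above), after which
`CornerTransfer_of` is the crux proof; equivalently `CornerTransfer` follows in three lines from the landed
`Cruxes.LimitRotationInvariant.QuarterTurnLiouville.limitRotationInvariant_proof` applied to `HRP2Rigidity_of`
(item stmt-1980, closed/proved 2026-08-16T22:39Z).  Hypothesis (P) of the crux is not used by this line: isotropy of
the `ℤ³` limit is by now unconditional in the tree.  This file deliberately imports NO `Theorems` module, so that the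
stubs stay honest `sorry`s and the BC3 probes run in the bare route context (route file + HarnessLib only).

ROUTE CONSEQUENCE (for the tenure planner; details in `Lines/birth.md`): by the route's own KILL CRITERIA ("If
HyperoctahedralRP proves LimitRotationInvariant first, this route is superseded for the assembly but CornerTransfer
stays wanted as an independent mechanism") the ASSEMBLY role of `CornerTransfer` is superseded; the corner MECHANISM
(layered theory `T₀`, crossover window, corner universality — refuter REVIEW-R1 objection O1: absent from the typed
layer) survives only if re-typed as an independent universality statement over the landed
`Literature.Probability.LatticeModels.AnisotropicIsing` notions (definition request D1 has landed).

## Disproof used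

None exists at registration: `ledger crux ls stmt-CriticalPhenomena-4631` → no workfiles (no `Disproof.lean`, no
`Lines/`, no `Ideas/`); no `Theorems/CornerTransfer/Negative/` lemma; no dead lines; `ledger negatives --problem
CriticalPhenomena` has no statement about `CornerTransfer`.  Nearest negative knowledge honoured: the coincident-locus
junk values of `Theorems/IsingEuclidUpgradeRefutations.lean` (item 0637) — `stub_nPointUpgradeFromTwoPoint` carries
the normalisation (H3) verbatim and `stub_twoPointIsotropy` concludes only off the origin (`x ≠ 0`).

## BC3 audit (raw outputs in the seat's NOTES.md `birth-certificate:` and in `Lines/birth.md`)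

`lean check --json` of this file: rc 0, errors [], sorries = 2 = #stubs (the two `stub_*` declarations), zero
elsewhere (`CornerTransfer_of` and the `Statement.*` abbrevs are sorry-free).  Probes (bare route context, `set_option
maxHeartbeats 400000`, tactic `first | exact? | simpa [C] | (unfold C; simpa) | aesop`): `stub → CornerTransfer` and
`stub → Ising3DConformalLimit` FAIL for both stubs (4/4), as do the unfolded `exact?` / `aesop` / `simpa using`
variants.
-/

namespace Summit.CriticalPhenomena.Ising3DConformalLimit.Cruxes.CornerTransfer.Birth

/-! ## The stubs (the ONLY `sorry`s of the file) -/

/-- STUB 1 (order 2: two-point isotropy of the limit kernel off the origin).  For every pointwise scaling limit `S`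
of `criticalCorr 3` (renormalisation `ρ > 0` on `(0,1]`) that is non-degenerate, translation invariant and scale
covariant with dimension `Δ`: `S 2 ![0, R x] = S 2 ![0, x]` for all linear isometries `R` of `ℝ³` and all `x ≠ 0`.
Verbatim item stmt-CriticalPhenomena-1984 (`HyperoctahedralRP.TwoPointLimitIsotropic`, closed/proved by
`HyperoctahedralRPTwoPoint.twoPointLimitIsotropic_proof`).  Why plausibly true: it is a theorem of the tree.
Size: XL as mathematics, XS by citation. -/
theorem stub_twoPointIsotropy :
    ∀ (ρ : ℝ → ℝ) (Δ : ℝ) (S : Literature.Probability.LatticeModels.CorrFamily 3),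
      (∀ δ ∈ Set.Ioc (0:ℝ) 1, 0 < ρ δ) →
      Literature.Probability.LatticeModels.HasPointwiseScalingLimit
        (Literature.Probability.LatticeModels.criticalCorr 3) ρ S →
      Literature.Probability.LatticeModels.IsNondegenerateTwoPoint S →
      Literature.Probability.LatticeModels.IsTranslationInvariant S →
      Literature.Probability.LatticeModels.IsScaleCovariant Δ S →
      ∀ (R : EuclideanSpace ℝ (Fin 3) ≃ₗᵢ[ℝ] EuclideanSpace ℝ (Fin 3)) (x : EuclideanSpace ℝ (Fin 3)),
        x ≠ 0 → S 2 ![0, R x] = S 2 ![0, x] := by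
  sorry

/-- STUB 2 (orders `≥ 3`: the n-point upgrade).  Every normalised, non-degenerate, translation-invariant,
scale-covariant pointwise scaling limit `S` of `criticalCorr 3` whose two-point kernel is isometry-invariant off `0`
is `IsRotationInvariant` (all orders, all of `O(3)` incl. reflections).  Verbatim item stmt-CriticalPhenomena-8367
(`GaussianScaleMixture.RotationUpgradeFromTwoPoint`, closed/proved by
`Cruxes.RotationUpgradeFromTwoPoint.NullLaplacianEdgeGaussianity.RotationUpgradeFromTwoPoint_of`).  Why plausibly
true: it is a theorem of the tree.  Size: XL as mathematics, XS by citation. -/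
theorem stub_nPointUpgradeFromTwoPoint :
    ∀ (ρ : ℝ → ℝ) (Δ : ℝ) (S : Literature.Probability.LatticeModels.CorrFamily 3),
      (∀ δ ∈ Set.Ioc (0:ℝ) 1, 0 < ρ δ) →
      Literature.Probability.LatticeModels.HasPointwiseScalingLimit
        (Literature.Probability.LatticeModels.criticalCorr 3) ρ S →
      (∀ n z, z ∉ Literature.Probability.LatticeModels.NonCoincident 3 n → S n z = 0) →
      Literature.Probability.LatticeModels.IsNondegenerateTwoPoint S →
      Literature.Probability.LatticeModels.IsTranslationInvariant S →
      Literature.Probability.LatticeModels.IsScaleCovariant Δ S →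
      (∀ (R : EuclideanSpace ℝ (Fin 3) ≃ₗᵢ[ℝ] EuclideanSpace ℝ (Fin 3)) (x : EuclideanSpace ℝ (Fin 3)),
        x ≠ 0 → S 2 ![0, R x] = S 2 ![0, x]) →
      Literature.Probability.LatticeModels.IsRotationInvariant S := by
  sorry

/-! ## Names for the stub statements (hypotheses of the composition, BY NAME)

The layer-invariant audit admits, as hypotheses of the theorem that concludes the crux, only registered
obligations or the declared stubs by name; `Statement.stub_x` is the statement (the type) of `stub_x`. -/

namespace Statement

/-- Statement of `stub_twoPointIsotropy`. -/
abbrev stub_twoPointIsotropy : Prop := type_of% Birth.stub_twoPointIsotropy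
/-- Statement of `stub_nPointUpgradeFromTwoPoint`. -/
abbrev stub_nPointUpgradeFromTwoPoint : Prop := type_of% Birth.stub_nPointUpgradeFromTwoPoint

end Statement

/-! ## The composition (kernel-checked, no sorry): the two stubs give the crux BY NAME -/

/-- **`CornerTransfer` from the stubs** (`stub₁-sig → stub₂-sig → CornerTransfer`).  Given the planar hypothesis (P)
(not needed) and `(ρ, Δ, S)` with (H1)–(H6): STUB 1 supplies two-point kernel isotropy off `0`, STUB 2 upgrades it
to `IsRotationInvariant S`, which contains every linear isometry fixing `e₃`. -/
theorem CornerTransfer_of (h₁ : Statement.stub_twoPointIsotropy) (h₂ : Statement.stub_nPointUpgradeFromTwoPoint) :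
    Summit.CriticalPhenomena.Ising3DConformalLimit.Theses.PlanarCornerRotations.CornerTransfer := by
  intro _hP ρ Δ S hρ hlim hnorm hnd htr hsc R _hR n x
  have hiso : ∀ (R : EuclideanSpace ℝ (Fin 3) ≃ₗᵢ[ℝ] EuclideanSpace ℝ (Fin 3)) (x : EuclideanSpace ℝ (Fin 3)),
      x ≠ 0 → S 2 ![0, R x] = S 2 ![0, x] :=
    h₁ ρ Δ S hρ hlim hnd htr hsc
  have hrot : Literature.Probability.LatticeModels.IsRotationInvariant S :=
    h₂ ρ Δ S hρ hlim hnorm hnd htr hsc hiso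
  exact hrot n R x

/-- The same composition fed with the declared stubs: a closed term of type `CornerTransfer` whose only `sorry`s are
the two stubs (the day both are discharged — by citation — this IS the crux proof). -/
example : Summit.CriticalPhenomena.Ising3DConformalLimit.Theses.PlanarCornerRotations.CornerTransfer :=
  CornerTransfer_of stub_twoPointIsotropy stub_nPointUpgradeFromTwoPoint

end Summit.CriticalPhenomena.Ising3DConformalLimit.Cruxes.CornerTransfer.Birth
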